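import Mathlib.Probability.ConditionalExpectation
import Mathlib.MeasureTheory.Function.ConditionalExpectation.PullOut
import Mathlib.MeasureTheory.Function.ConditionalExpectation.Real
import Mathlib.MeasureTheory.Function.L2Space
import Mathlib.MeasureTheory.SetAlgebra
import Literature.Probability.Independence.IndepCondExp
import HarnessLib

/-!
# Tsirelson's first-chaos calculus and the abstract black-noise criterion

Topic `Literature/Probability/Independence`; pure measure theory (Mathlib only), written in
support of the named fact `Literature.Probability.Percolation.QuadCrossing.SchrammSmirnov2011_cor_1_8_black`
(`Percolation/QuadCrossingNoise.lean`: O. Schramm, S. Smirnov, *On the scaling limits of planar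
percolation*, Ann. Probab. 39 (2011), Cor. 1.8, "any subsequential scaling limit … has to be a
black noise, as explained in [Ts03], Remark 8a2").  The source proves blackness only by reference
to Tsirelson's pivotal-cell argument (B. Tsirelson, *Scaling limit, noise, stability*, Saint-Flour
2002 [Tsirelson2003], arXiv:math/0301237, §6.5 Lemma 113 – Cor. 117 and §8.1 Remark 137 =
"Remark 8a2": "the sum for `𝐇(f)` contains `O(1/ε²)` terms, `o(ε²)` each", the `o(ε)` being the
probability that an `ε`-cell is pivotal).  This file proves the ABSTRACT half of that argument —
a probability space, finitely many sub-`σ`-algebras, no percolation — in the elementary `L²` form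
in which the percolation proof consumes it (first chaos as in B. Tsirelson, *Noise as a Boolean
algebra of `σ`-fields*, Ann. Probab. 42 (2014), Def. 1.2: `f = E(f|x) + E(f|x')`):

* `integral_mul_condExp_eq` — self-adjointness `∫ f·E[g|m] = ∫ E[f|m]·E[g|m]`, and the
  `L²`-contractivity `integral_condExp_sq_le`;
* `integral_mul_eq_sum_of_ae_eq_sum`, `integral_sq_eq_sum_of_ae_eq_sum` — if
  `f = Σᵢ E[f|mᵢ]` a.e. (the cell decomposition of a first-chaos element) then
  `∫ f g = Σᵢ ∫ E[f|mᵢ] E[g|mᵢ]` and `∫ f² = Σᵢ ∫ E[f|mᵢ]²` (Tsirelson's `‖Q₁f‖² = 𝐇₁(f)`,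
  Lemma 115, for a fixed partition);
* `abs_integral_mul_le_of_ae_eq_sum` — hence, if moreover `∫ f = 0`,
  `|∫ f g| ≤ ‖f‖₂ · (Σᵢ ‖E[g|mᵢ] − cᵢ‖₂²)^{1/2}` for arbitrary constants `cᵢ` (Cor. 116: `g` with
  small `𝐇` is almost orthogonal to the first chaos); `integral_eq_zero_of_ae_eq_condExp_add` —
  `∫ f = 0` is automatic for a first-chaos element;
* `integral_sq_condExp_indicator_sub_le` — **the pivotal bound** (Lemma 113 specialised to
  indicators, which is Remark 8a2's "`o(ε²)` each"): if `x, y` are independent `σ`-algebras and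
  `A⁻ ⊆ A ⊆ A⁺` up to null sets with `A⁻, A⁺ ∈ y`, then
  `∫ (E[𝟙_A | x] − μ(A))² ≤ μ(A⁺ ∖ A⁻)²` — the SQUARE of the pivotality probability, proved by
  duality without disintegration;
* `ae_eq_zero_of_forall_setIntegral_eq_zero_of_generateFrom` — the concluding `π`-`λ` step:
  an integrable `f` with `∫ f = 0` and `∫_A f = 0` for all `A` in a `π`-system generating the
  `σ`-algebra vanishes a.e.;
* `condExp_ae_eq_condExp_of_forall_ae_eq` — conditioning is insensitive to null sets
  (`E[f|m₁] = E[f|m₂]` a.e. when `m₂ ≤ m₁ ⊆ m₂` mod `μ`); `condExp_sup_ae_eq_condExp_of_indep` —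
  an independent `σ`-algebra drops out of the conditioning, `E[h | 𝓖 ∨ 𝓣] = E[h | 𝓖]` for `h`
  `𝓐`-measurable, `𝓖 ≤ 𝓐`, `𝓣` independent of `𝓐` (function form of the set statements of
  `IndepCondExp.lean`);
* `condExp_biUnion_ae_eq_sum_of_firstChaos`, `ae_eq_sum_condExp_of_firstChaos` — **the cell
  decomposition of a first-chaos element**: for a monotone assignment `W ↦ F W` of `σ`-algebras
  to a Boolean algebra of sets with `F ∅` trivial, `F W` independent of `F Wᶜ` and the
  factorization `F (V ∪ W) ⊆ F V ∨ F W` mod `μ` for disjoint `V, W` (Tsirelson 2014, Def. 1.1: a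
  noise-type Boolean algebra; for percolation limits: Schramm–Smirnov Cor. 1.8 with Thm. 1.7), an
  `f` with `f = E[f | F W] + E[f | F Wᶜ]` for all `W` (Def. 1.2: the first chaos) satisfies
  `f = Σᵢ E[f | F (C i)]` a.e. and `∫ f = 0` for every finite partition into cells `C i`;
* `ae_eq_zero_of_cellDecomposition_of_pivotal` — everything combined into **the abstract
  blackness criterion**: if `f ∈ L²`, `∫ f = 0`, `f = Σ_{i ∈ P n} E[f | m n i]` a.e. along a
  sequence of finite families of cell `σ`-algebras with independent companions `m' n i`, and
  every event of a generating `π`-system is sandwiched by `m' n i`-events with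
  `Σᵢ μ(A⁺ ∖ A⁻)² → 0`, then `f = 0` a.e. (Cor. 117: "if `𝐇(f) = 0` for all `f` then the noise
  is black"); `ae_eq_zero_of_forall_exists_cellDecomposition` — the same in `ε`-form, the finite
  family of cells being allowed to depend on the event and on `ε`.

What remains for `SchrammSmirnov2011_cor_1_8_black_holds` (NOT here, percolation-specific): the
hypotheses of `ae_eq_sum_condExp_of_firstChaos` for `W ↦ 𝓕_{int(D ∩ W)}` on the rectangle base
(the noise property `SchrammSmirnov2011_cor_1_8_noise`, and the factorization of adjacent
rectangles from `SchrammSmirnov2011_thm_1_7`), the sandwich events `A⁻ ⊆ ⊞ ⊆ A⁺` of a crossing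
event by events away from a cell, and the estimate `Σ_cells μ(A⁺ ∖ A⁻)² → 0` (four-arm and
boundary-arm bounds transported to the limit).  Tsirelson's general notions (noise, `𝐇`, `𝐇₁`,
spectral measures) are deliberately not introduced: only the identities and inequalities are.

## References

* B. Tsirelson, *Scaling limit, noise, stability*, in: Lectures on Probability Theory and
  Statistics, LNM 1840 (2004) 1–106, arXiv:math/0301237, §6.5 (Lemma 113, Lemma 115, Cor. 116,
  Cor. 117 of the arXiv version), §8.1 Remark 137. [Tsirelson2003]
* B. Tsirelson, *Noise as a Boolean algebra of `σ`-fields*, Ann. Probab. 42 (2014) 311–353,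
  Def. 1.2–1.3. [Tsirelson2014]
* O. Schramm, S. Smirnov, *On the scaling limits of planar percolation*, Ann. Probab. 39 (2011)
  1768–1814, Cor. 1.8. [SchrammSmirnov2011]
-/

noncomputable section

open _root_.MeasureTheory _root_.ProbabilityTheory Filter Set
open scoped ENNReal

namespace Literature.Probability.Independence

section FirstChaosCalculus

variable {Ω : Type*} {mΩ : MeasurableSpace Ω} {μ : Measure Ω}

/-! ### Cauchy–Schwarz in the real `L²` form -/

/-- Cauchy–Schwarz for real square-integrable functions: `|∫ f g| ≤ √(∫ f²) √(∫ g²)`. [folklore] -/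
theorem abs_integral_mul_le_sqrt_mul_sqrt {f g : Ω → ℝ} (hf : MemLp f 2 μ) (hg : MemLp g 2 μ) :
    |∫ x, f x * g x ∂μ| ≤ √(∫ x, f x ^ 2 ∂μ) * √(∫ x, g x ^ 2 ∂μ) := by
  have h := integral_mul_norm_le_Lp_mul_Lq (μ := μ) (f := fun x => ‖f x‖) (g := fun x => ‖g x‖)
    Real.HolderConjugate.two_two (by simpa using hf.norm) (by simpa using hg.norm)
  simp only [norm_norm, Real.rpow_two, one_div, Real.sqrt_eq_rpow] at h ⊢
  simp only [Real.norm_eq_abs, sq_abs] at h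
  refine le_trans ?_ h
  refine abs_integral_le_integral_abs.trans (le_of_eq ?_)
  exact integral_congr_ae (Eventually.of_forall fun x => abs_mul _ _)

/-- If `0 ≤ A ≤ √B · √A` with `B ≥ 0` then `A ≤ B` (divide by `√A`). [folklore] -/
theorem le_of_sqrt_mul_sqrt_le {A B : ℝ} (hA : 0 ≤ A) (hB : 0 ≤ B) (h : A ≤ √B * √A) : A ≤ B := by
  have hsq : √A * √A ≤ √B * √A := by rwa [Real.mul_self_sqrt hA]
  rcases eq_or_lt_of_le (Real.sqrt_nonneg A) with h0 | hpos
  · have hA' : A = 0 := le_antisymm (Real.sqrt_eq_zero'.1 h0.symm) hA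
    rw [hA']
    exact hB
  · have h1 : √A ≤ √B := le_of_mul_le_mul_right hsq hpos
    calc A = √A * √A := (Real.mul_self_sqrt hA).symm
      _ ≤ √B * √B := mul_le_mul h1 h1 (Real.sqrt_nonneg _) (Real.sqrt_nonneg _)
      _ = B := Real.mul_self_sqrt hB

/-! ### Self-adjointness of conditional expectation on `L²` -/

variable [IsFiniteMeasure μ]

/-- **Self-adjointness**: for square-integrable real `f, g` and a sub-`σ`-algebra `m`,
`∫ f · E[g|m] = ∫ E[f|m] · E[g|m]` (pull-out property and `∫ E[·|m] = ∫ ·`). [folklore] -/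
theorem integral_mul_condExp_eq {m : MeasurableSpace Ω} (hm : m ≤ mΩ) {f g : Ω → ℝ}
    (hf : MemLp f 2 μ) (hg : MemLp g 2 μ) :
    ∫ x, f x * (μ[g|m]) x ∂μ = ∫ x, (μ[f|m]) x * (μ[g|m]) x ∂μ := by
  have hgm : StronglyMeasurable[m] (μ[g|m]) := stronglyMeasurable_condExp
  have hg2 : MemLp (μ[g|m]) 2 μ := hg.condExp one_le_two
  have hfg : Integrable (f * μ[g|m]) μ := hf.integrable_mul hg2
  have hfi : Integrable f μ := hf.integrable one_le_two
  have hpull : μ[f * μ[g|m]|m] =ᵐ[μ] μ[f|m] * μ[g|m] :=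
    condExp_mul_of_stronglyMeasurable_right hgm hfg hfi
  calc ∫ x, f x * (μ[g|m]) x ∂μ = ∫ x, (f * μ[g|m]) x ∂μ := rfl
    _ = ∫ x, (μ[f * μ[g|m]|m]) x ∂μ := (integral_condExp hm).symm
    _ = ∫ x, (μ[f|m] * μ[g|m]) x ∂μ := integral_congr_ae hpull
    _ = ∫ x, (μ[f|m]) x * (μ[g|m]) x ∂μ := rfl

/-- `∫ E[f|m] · g = ∫ E[f|m] · E[g|m]`, the mirror image of `integral_mul_condExp_eq`. [folklore] -/
theorem integral_condExp_mul_eq {m : MeasurableSpace Ω} (hm : m ≤ mΩ) {f g : Ω → ℝ}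
    (hf : MemLp f 2 μ) (hg : MemLp g 2 μ) :
    ∫ x, (μ[f|m]) x * g x ∂μ = ∫ x, (μ[f|m]) x * (μ[g|m]) x ∂μ := by
  have h := integral_mul_condExp_eq hm hg hf
  simp_rw [mul_comm (g _)] at h
  rw [h]
  simp_rw [mul_comm]

/-- **Contractivity in `L²`**: `∫ E[f|m]² ≤ ∫ f²`. [folklore] -/
theorem integral_condExp_sq_le {m : MeasurableSpace Ω} (hm : m ≤ mΩ) {f : Ω → ℝ}
    (hf : MemLp f 2 μ) : ∫ x, (μ[f|m]) x ^ 2 ∂μ ≤ ∫ x, f x ^ 2 ∂μ := by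
  have hf2 : MemLp (μ[f|m]) 2 μ := hf.condExp one_le_two
  have hA0 : 0 ≤ ∫ x, (μ[f|m]) x ^ 2 ∂μ := integral_nonneg fun x => sq_nonneg _
  have hB0 : 0 ≤ ∫ x, f x ^ 2 ∂μ := integral_nonneg fun x => sq_nonneg _
  -- `A = ∫ f · E[f|m] ≤ √B √A`
  have hAeq : ∫ x, (μ[f|m]) x ^ 2 ∂μ = ∫ x, f x * (μ[f|m]) x ∂μ := by
    rw [integral_mul_condExp_eq hm hf hf]
    exact integral_congr_ae (Eventually.of_forall fun x => by simp [sq])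
  have hle : ∫ x, (μ[f|m]) x ^ 2 ∂μ ≤ √(∫ x, f x ^ 2 ∂μ) * √(∫ x, (μ[f|m]) x ^ 2 ∂μ) :=
    calc ∫ x, (μ[f|m]) x ^ 2 ∂μ = ∫ x, f x * (μ[f|m]) x ∂μ := hAeq
      _ ≤ |∫ x, f x * (μ[f|m]) x ∂μ| := le_abs_self _
      _ ≤ √(∫ x, f x ^ 2 ∂μ) * √(∫ x, (μ[f|m]) x ^ 2 ∂μ) :=
        abs_integral_mul_le_sqrt_mul_sqrt hf hf2
  exact le_of_sqrt_mul_sqrt_le hA0 hB0 hle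

/-! ### The cell decomposition `f = Σᵢ E[f|mᵢ]` and its consequences -/

variable {ι : Type*}

/-- If `f = Σᵢ E[f|mᵢ]` a.e. (finite sum) then `∫ f g = Σᵢ ∫ E[f|mᵢ] · E[g|mᵢ]` for every
square-integrable `g` (Tsirelson 2003, proof of Lemma 115: the first chaos is the orthogonal sum
of its cell components). [cite: Tsirelson2003, §6.5 Lemma 115 (arXiv math/0301237)] -/
theorem integral_mul_eq_sum_of_ae_eq_sum (s : Finset ι) {m : ι → MeasurableSpace Ω}
    (hm : ∀ i ∈ s, m i ≤ mΩ) {f g : Ω → ℝ} (hf : MemLp f 2 μ) (hg : MemLp g 2 μ)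
    (hdec : f =ᵐ[μ] fun x => ∑ i ∈ s, (μ[f|m i]) x) :
    ∫ x, f x * g x ∂μ = ∑ i ∈ s, ∫ x, (μ[f|m i]) x * (μ[g|m i]) x ∂μ := by
  have hint : ∀ i ∈ s, Integrable (fun x => (μ[f|m i]) x * g x) μ := fun i _ =>
    (hf.condExp one_le_two).integrable_mul hg
  calc ∫ x, f x * g x ∂μ = ∫ x, (∑ i ∈ s, (μ[f|m i]) x) * g x ∂μ := by
        refine integral_congr_ae ?_
        filter_upwards [hdec] with x hx
        rw [hx]
    _ = ∫ x, ∑ i ∈ s, (μ[f|m i]) x * g x ∂μ := by simp_rw [Finset.sum_mul]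
    _ = ∑ i ∈ s, ∫ x, (μ[f|m i]) x * g x ∂μ := integral_finsetSum s hint
    _ = ∑ i ∈ s, ∫ x, (μ[f|m i]) x * (μ[g|m i]) x ∂μ :=
        Finset.sum_congr rfl fun i hi => integral_condExp_mul_eq (hm i hi) hf hg

/-- **Parseval for the cell decomposition**: if `f = Σᵢ E[f|mᵢ]` a.e. then
`∫ f² = Σᵢ ∫ E[f|mᵢ]²` (`‖Q₁ f‖² = Σ ‖E(f|𝓕_cell)‖²`, Tsirelson 2003 Lemma 115 for a fixed
partition). [cite: Tsirelson2003, §6.5 Lemma 115 (arXiv math/0301237)] -/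
theorem integral_sq_eq_sum_of_ae_eq_sum (s : Finset ι) {m : ι → MeasurableSpace Ω}
    (hm : ∀ i ∈ s, m i ≤ mΩ) {f : Ω → ℝ} (hf : MemLp f 2 μ)
    (hdec : f =ᵐ[μ] fun x => ∑ i ∈ s, (μ[f|m i]) x) :
    ∫ x, f x ^ 2 ∂μ = ∑ i ∈ s, ∫ x, (μ[f|m i]) x ^ 2 ∂μ := by
  have h := integral_mul_eq_sum_of_ae_eq_sum s hm hf hf hdec
  simp only [← sq] at h
  exact h

/-- **A first-chaos element is almost orthogonal to functions with small cell fluctuations**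
(Tsirelson 2003, Cor. 116 in quantitative form): if `f = Σᵢ E[f|mᵢ]` a.e. and `∫ f = 0`, then
for every square-integrable `g` and arbitrary constants `cᵢ`,
`|∫ f g| ≤ √(∫ f²) · √(Σᵢ ∫ (E[g|mᵢ] − cᵢ)²)`. [cite: Tsirelson2003, §6.5 Cor. 116 (arXiv math/0301237)] -/
theorem abs_integral_mul_le_of_ae_eq_sum (s : Finset ι) {m : ι → MeasurableSpace Ω}
    (hm : ∀ i ∈ s, m i ≤ mΩ) {f g : Ω → ℝ} (hf : MemLp f 2 μ) (hg : MemLp g 2 μ)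
    (hf0 : ∫ x, f x ∂μ = 0) (hdec : f =ᵐ[μ] fun x => ∑ i ∈ s, (μ[f|m i]) x) (c : ι → ℝ) :
    |∫ x, f x * g x ∂μ| ≤
      √(∫ x, f x ^ 2 ∂μ) * √(∑ i ∈ s, ∫ x, ((μ[g|m i]) x - c i) ^ 2 ∂μ) := by
  have hfi : ∀ i, MemLp (μ[f|m i]) 2 μ := fun i => hf.condExp one_le_two
  have hgi : ∀ i, MemLp (fun x => (μ[g|m i]) x - c i) 2 μ := fun i =>
    (hg.condExp one_le_two).sub (memLp_const _)
  -- centre the second factor: `∫ E[f|mᵢ] · cᵢ = cᵢ ∫ f = 0`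
  have hcentre : ∀ i ∈ s, ∫ x, (μ[f|m i]) x * (μ[g|m i]) x ∂μ =
      ∫ x, (μ[f|m i]) x * ((μ[g|m i]) x - c i) ∂μ := by
    intro i hi
    have h1 : Integrable (fun x => (μ[f|m i]) x * (μ[g|m i]) x) μ :=
      (hfi i).integrable_mul (hg.condExp one_le_two)
    have h2 : Integrable (fun x => (μ[f|m i]) x * c i) μ :=
      ((hfi i).integrable one_le_two).mul_const _
    have h0 : ∫ x, (μ[f|m i]) x * c i ∂μ = 0 := by
      rw [integral_mul_const, integral_condExp (hm i hi), hf0, zero_mul]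
    simp_rw [mul_sub]
    rw [integral_sub h1 h2, h0, sub_zero]
  rw [integral_mul_eq_sum_of_ae_eq_sum s hm hf hg hdec, Finset.sum_congr rfl hcentre]
  calc |∑ i ∈ s, ∫ x, (μ[f|m i]) x * ((μ[g|m i]) x - c i) ∂μ|
      ≤ ∑ i ∈ s, |∫ x, (μ[f|m i]) x * ((μ[g|m i]) x - c i) ∂μ| := Finset.abs_sum_le_sum_abs _ _
    _ ≤ ∑ i ∈ s, √(∫ x, (μ[f|m i]) x ^ 2 ∂μ) * √(∫ x, ((μ[g|m i]) x - c i) ^ 2 ∂μ) :=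
        Finset.sum_le_sum fun i _ => abs_integral_mul_le_sqrt_mul_sqrt (hfi i) (hgi i)
    _ ≤ √(∑ i ∈ s, ∫ x, (μ[f|m i]) x ^ 2 ∂μ) * √(∑ i ∈ s, ∫ x, ((μ[g|m i]) x - c i) ^ 2 ∂μ) :=
        Real.sum_sqrt_mul_sqrt_le s (fun i => integral_nonneg fun x => sq_nonneg _)
          (fun i => integral_nonneg fun x => sq_nonneg _)
    _ = √(∫ x, f x ^ 2 ∂μ) * √(∑ i ∈ s, ∫ x, ((μ[g|m i]) x - c i) ^ 2 ∂μ) := by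
        rw [← integral_sq_eq_sum_of_ae_eq_sum s hm hf hdec]

/-- The hypothesis `∫ f = 0` of `abs_integral_mul_le_of_ae_eq_sum` is automatic for an element
of the first chaos: if `f = E[f|m] + E[f|m']` a.e. for ONE pair of sub-`σ`-algebras then
`∫ f = 2 ∫ f`, so `∫ f = 0`. [cite: Tsirelson2014, Def. 1.2] -/
theorem integral_eq_zero_of_ae_eq_condExp_add {m m' : MeasurableSpace Ω} (hm : m ≤ mΩ)
    (hm' : m' ≤ mΩ) {f : Ω → ℝ} (h : f =ᵐ[μ] μ[f|m] + μ[f|m']) : ∫ x, f x ∂μ = 0 := by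
  have h1 : ∫ x, f x ∂μ = ∫ x, (μ[f|m]) x ∂μ + ∫ x, (μ[f|m']) x ∂μ := by
    rw [integral_congr_ae h, ← integral_add integrable_condExp integrable_condExp]
    rfl
  rw [integral_condExp hm, integral_condExp hm'] at h1
  linarith

end FirstChaosCalculus

/-! ### The pivotal bound (Tsirelson 2003, Lemma 113, for indicators) -/

section Pivotal

variable {Ω : Type*} {mΩ : MeasurableSpace Ω} {μ : Measure Ω} [IsProbabilityMeasure μ]

/-- On a probability space `∫ |u| ≤ √(∫ u²)`. [folklore] -/
theorem integral_abs_le_sqrt_integral_sq {u : Ω → ℝ} (hu : MemLp u 2 μ) :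
    ∫ ω, |u ω| ∂μ ≤ √(∫ ω, u ω ^ 2 ∂μ) := by
  have habs : MemLp (fun ω => |u ω|) 2 μ := by simpa [Real.norm_eq_abs] using hu.norm
  have h := abs_integral_mul_le_sqrt_mul_sqrt habs (memLp_const (1 : ℝ))
  simp only [mul_one, one_pow, integral_const, smul_eq_mul, probReal_univ, Real.sqrt_one,
    sq_abs] at h
  exact (le_abs_self _).trans h

/-- Independence in integrated form: for `u` `x`-measurable and integrable, `B ∈ y`, `x, y`
independent, `∫_B u = μ(B) · ∫ u`. [folklore] -/
theorem setIntegral_eq_mul_integral_of_indep {x y : MeasurableSpace Ω} (hx : x ≤ mΩ) (hy : y ≤ mΩ)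
    (hind : Indep x y μ) {u : Ω → ℝ} (hux : StronglyMeasurable[x] u) (hui : Integrable u μ)
    {B : Set Ω} (hB : MeasurableSet[y] B) :
    ∫ ω in B, u ω ∂μ = μ.real B * ∫ ω, u ω ∂μ := by
  have hconst : μ[u|y] =ᵐ[μ] fun _ => ∫ ω, u ω ∂μ := condExp_indep_eq hx hy hux hind
  calc ∫ ω in B, u ω ∂μ = ∫ ω in B, (μ[u|y]) ω ∂μ := (setIntegral_condExp hy hui hB).symm
    _ = ∫ ω in B, (fun _ => ∫ ω', u ω' ∂μ) ω ∂μ := by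
        refine setIntegral_congr_ae (hy _ hB) ?_
        filter_upwards [hconst] with ω hω _ using hω
    _ = μ.real B * ∫ ω, u ω ∂μ := by rw [setIntegral_const, smul_eq_mul]

/-- **The pivotal bound** (Tsirelson 2003, Lemma 113 `√Var(E(f|𝓕_{s,t})) ≤ E √Var(f|𝓕_{ℝ∖(s,t)})`,
specialised to an indicator `f = 𝟙_A` sandwiched between two events of the complementary
`σ`-algebra, which is the form used in Remark 8a2: "the critical exponent for a small cell …
being pivotal … `o(ε)` … `o(ε²)` each").  Let `x, y` be independent sub-`σ`-algebras of a
probability space, `A` an event and `A⁻ ⊆ A ⊆ A⁺` up to null sets with `A⁻, A⁺ ∈ y` ("the status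
of `A` is decided outside the cell unless the cell is pivotal", pivotality `⊆ A⁺ ∖ A⁻`).  Then
`∫ (E[𝟙_A | x] − μ(A))² ≤ μ(A⁺ ∖ A⁻)²`.  Proof (duality, no disintegration): with
`u = E[𝟙_A|x] − μ(A)` (`x`-measurable, mean zero), `∫ u² = ∫ u 𝟙_A = ∫ u (𝟙_A − 𝟙_{A⁻})`
(`∫ u 𝟙_{A⁻} = μ(A⁻) ∫ u = 0` by independence) `≤ ∫_{A⁺∖A⁻} |u| = μ(A⁺∖A⁻) ∫ |u|`
(independence) `≤ μ(A⁺∖A⁻) ‖u‖₂`. [cite: Tsirelson2003, §6.5 Lemma 113 and §8.1 Remark 137 (arXiv math/0301237)] -/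
theorem integral_sq_condExp_indicator_sub_le {x y : MeasurableSpace Ω} (hx : x ≤ mΩ)
    (hy : y ≤ mΩ) (hind : Indep x y μ) {A Am Ap : Set Ω} (hA : MeasurableSet[mΩ] A)
    (hAm : MeasurableSet[y] Am) (hAp : MeasurableSet[y] Ap) (hmA : ∀ᵐ ω ∂μ, ω ∈ Am → ω ∈ A)
    (hAp' : ∀ᵐ ω ∂μ, ω ∈ A → ω ∈ Ap) :
    ∫ ω, ((μ[A.indicator fun _ => (1 : ℝ)|x]) ω - μ.real A) ^ 2 ∂μ ≤ (μ.real (Ap \ Am)) ^ 2 := by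
  set χ : Ω → ℝ := A.indicator fun _ => 1 with hχ
  set χm : Ω → ℝ := Am.indicator fun _ => 1 with hχm
  set u : Ω → ℝ := fun ω => (μ[χ|x]) ω - μ.real A with hu
  have hAm' : MeasurableSet[mΩ] Am := hy _ hAm
  have hχ2 : MemLp χ 2 μ := memLp_indicator_const 2 hA (1 : ℝ) (Or.inr (measure_ne_top _ _))
  have hχm2 : MemLp χm 2 μ := memLp_indicator_const 2 hAm' (1 : ℝ) (Or.inr (measure_ne_top _ _))
  have hχi : Integrable χ μ := hχ2.integrable one_le_two
  have hux : StronglyMeasurable[x] u := stronglyMeasurable_condExp.sub stronglyMeasurable_const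
  have hu2 : MemLp u 2 μ := (hχ2.condExp one_le_two).sub (memLp_const _)
  have hui : Integrable u μ := hu2.integrable one_le_two
  have huabs : StronglyMeasurable[x] fun ω => |u ω| := hux.norm
  have huabsi : Integrable (fun ω => |u ω|) μ := hui.abs
  -- (1) `∫ u = 0`
  have hχint : ∫ ω, χ ω ∂μ = μ.real A := by
    rw [hχ, integral_indicator hA, setIntegral_const, smul_eq_mul, mul_one]
  have hu0 : ∫ ω, u ω ∂μ = 0 := by
    simp only [hu]
    rw [integral_sub integrable_condExp (integrable_const _), integral_condExp hx, hχint,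
      integral_const, smul_eq_mul, probReal_univ, one_mul, sub_self]
  -- (2) `∫ u² = ∫ u χ`
  have hpull : μ[u * χ|x] =ᵐ[μ] u * μ[χ|x] :=
    condExp_mul_of_stronglyMeasurable_left hux (hu2.integrable_mul hχ2) hχi
  have h2 : ∫ ω, u ω ^ 2 ∂μ = ∫ ω, u ω * χ ω ∂μ := by
    have e1 : ∀ ω, u ω ^ 2 = u ω * (μ[χ|x]) ω - μ.real A * u ω := fun ω => by
      simp only [hu]; ring
    have hI : Integrable (fun ω => u ω * (μ[χ|x]) ω) μ :=
      hu2.integrable_mul (hχ2.condExp one_le_two)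
    calc ∫ ω, u ω ^ 2 ∂μ = ∫ ω, (u ω * (μ[χ|x]) ω - μ.real A * u ω) ∂μ :=
          integral_congr_ae (Eventually.of_forall e1)
      _ = ∫ ω, u ω * (μ[χ|x]) ω ∂μ - μ.real A * ∫ ω, u ω ∂μ := by
          rw [integral_sub hI (hui.const_mul _), integral_const_mul]
      _ = ∫ ω, u ω * (μ[χ|x]) ω ∂μ := by rw [hu0, mul_zero, sub_zero]
      _ = ∫ ω, (μ[u * χ|x]) ω ∂μ := (integral_congr_ae hpull).symm
      _ = ∫ ω, u ω * χ ω ∂μ := integral_condExp hx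
  -- (3) `∫ u χ⁻ = 0`
  have h3 : ∫ ω, u ω * χm ω ∂μ = 0 := by
    have e3 : ∀ ω, u ω * χm ω = Am.indicator u ω := fun ω => by
      by_cases h : ω ∈ Am <;> simp [hχm, h]
    rw [integral_congr_ae (Eventually.of_forall e3), integral_indicator hAm',
      setIntegral_eq_mul_integral_of_indep hx hy hind hux hui hAm, hu0, mul_zero]
  -- (4) `∫ u (χ − χ⁻) ≤ ∫_{A⁺∖A⁻} |u| = μ(A⁺∖A⁻) ∫ |u|`
  have h4 : ∫ ω, u ω * χ ω ∂μ ≤ μ.real (Ap \ Am) * ∫ ω, |u ω| ∂μ := by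
    have hle : ∀ᵐ ω ∂μ, u ω * χ ω - u ω * χm ω ≤ (Ap \ Am).indicator (fun ω => |u ω|) ω := by
      filter_upwards [hmA, hAp'] with ω h1 h2
      by_cases hm : ω ∈ Am
      · have hAω : ω ∈ A := h1 hm
        simp [hχ, hχm, hm, hAω]
      · by_cases hAω : ω ∈ A
        · have hp : ω ∈ Ap \ Am := ⟨h2 hAω, hm⟩
          simp only [hχ, hχm, Set.indicator_of_mem hAω, Set.indicator_of_notMem hm,
            Set.indicator_of_mem hp, mul_one, mul_zero, sub_zero]
          exact le_abs_self _
        · simp only [hχ, hχm, Set.indicator_of_notMem hAω, Set.indicator_of_notMem hm, mul_zero,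
            sub_zero]
          exact Set.indicator_nonneg (fun _ _ => abs_nonneg _) _
    have hI1 : Integrable (fun ω => u ω * χ ω) μ := hu2.integrable_mul hχ2
    have hI2 : Integrable (fun ω => u ω * χm ω) μ := hu2.integrable_mul hχm2
    calc ∫ ω, u ω * χ ω ∂μ = ∫ ω, (u ω * χ ω - u ω * χm ω) ∂μ := by
          rw [integral_sub hI1 hI2, h3, sub_zero]
      _ ≤ ∫ ω, (Ap \ Am).indicator (fun ω => |u ω|) ω ∂μ :=
          integral_mono_ae (hI1.sub hI2) (huabsi.indicator (hy _ (hAp.diff hAm))) hle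
      _ = μ.real (Ap \ Am) * ∫ ω, |u ω| ∂μ := by
          rw [integral_indicator (hy _ (hAp.diff hAm)),
            setIntegral_eq_mul_integral_of_indep hx hy hind huabs huabsi (hAp.diff hAm)]
  -- (5) combine with `∫ |u| ≤ √(∫ u²)`
  have hp0 : 0 ≤ μ.real (Ap \ Am) := measureReal_nonneg
  have hA0 : 0 ≤ ∫ ω, u ω ^ 2 ∂μ := integral_nonneg fun ω => sq_nonneg _
  have key : ∫ ω, u ω ^ 2 ∂μ ≤ √((μ.real (Ap \ Am)) ^ 2) * √(∫ ω, u ω ^ 2 ∂μ) := by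
    rw [Real.sqrt_sq hp0, h2]
    refine h4.trans ?_
    rw [← h2]
    exact mul_le_mul_of_nonneg_left (integral_abs_le_sqrt_integral_sq hu2) hp0
  exact le_of_sqrt_mul_sqrt_le hA0 (sq_nonneg _) key

end Pivotal

/-! ### The concluding `π`-`λ` step -/

section PiSystem

variable {Ω : Type*} {mΩ : MeasurableSpace Ω} {μ : Measure Ω}

/-- An integrable `f` with `∫ f = 0` whose integrals over the members of a `π`-system generating
the `σ`-algebra vanish is zero a.e. (Dynkin's `π`-`λ` theorem: the sets with `∫_A f = 0` form a
`λ`-system). [folklore] -/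
theorem ae_eq_zero_of_forall_setIntegral_eq_zero_of_generateFrom {S : Set (Set Ω)}
    (hgen : mΩ = MeasurableSpace.generateFrom S) (hS : IsPiSystem S) {f : Ω → ℝ}
    (hf : Integrable f μ) (h0 : ∫ ω, f ω ∂μ = 0) (hA : ∀ A ∈ S, ∫ ω in A, f ω ∂μ = 0) :
    f =ᵐ[μ] 0 := by
  have key : ∀ t, MeasurableSet t → ∫ ω in t, f ω ∂μ = 0 := by
    intro t ht
    induction t, ht using MeasurableSpace.induction_on_inter hgen hS with
    | empty => simp
    | basic t ht => exact hA t ht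
    | compl t htm iht =>
      have h := integral_add_compl htm hf
      rw [iht, h0, zero_add] at h
      exact h
    | iUnion F hdisj hFm ihF =>
      rw [integral_iUnion hFm hdisj hf.integrableOn]
      simp [ihF]
  exact hf.ae_eq_zero_of_forall_setIntegral_eq_zero fun t ht _ => key t ht

end PiSystem

/-! ### Conditional expectations along `σ`-algebras equal up to null sets -/

section AETransport

variable {Ω : Type*} {mΩ : MeasurableSpace Ω} {μ : Measure Ω} [IsFiniteMeasure μ]

/-- **Conditioning is insensitive to null sets.** If `m₂ ≤ m₁` and every `m₁`-set is `μ`-a.e.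
equal to an `m₂`-set (so `m₁ = m₂` mod `μ`, the hypothesis being the unfolding of
`QuadCrossing.AEIncluded μ m₁ m₂`), then `E[f | m₁] = E[f | m₂]` a.e. (uniqueness of the
conditional expectation: `E[f|m₂]` is `m₁`-measurable and has the right integrals on `m₁`-sets).
This is how "we work up to sets of measure zero" (Schramm–Smirnov 2011, proof of Thm. 1.7) enters
the first-chaos identities. [folklore] -/
theorem condExp_ae_eq_condExp_of_forall_ae_eq {m₁ m₂ : MeasurableSpace Ω} (hm₂₁ : m₂ ≤ m₁)
    (hm₁ : m₁ ≤ mΩ) (h : ∀ s, MeasurableSet[m₁] s → ∃ t, MeasurableSet[m₂] t ∧ s =ᵐ[μ] t)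
    {f : Ω → ℝ} (hf : Integrable f μ) : μ[f|m₁] =ᵐ[μ] μ[f|m₂] := by
  have hm₂ : m₂ ≤ mΩ := hm₂₁.trans hm₁
  refine (ae_eq_condExp_of_forall_setIntegral_eq hm₁ hf
    (fun s _ _ => integrable_condExp.integrableOn) (fun s hs _ => ?_)
    (stronglyMeasurable_condExp.mono hm₂₁).aestronglyMeasurable).symm
  obtain ⟨t, ht, hst⟩ := h s hs
  rw [setIntegral_congr_set hst, setIntegral_congr_set hst, setIntegral_condExp hm₂ hf ht]

end AETransport

/-! ### An independent `σ`-algebra drops out of the conditioning (function form) -/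

section DropIndep

variable {Ω : Type*} {mΩ : MeasurableSpace Ω} {μ : Measure Ω} [IsFiniteMeasure μ]

/-- Set integrals of `E[h | 𝓖]` over `𝓖 ∨ 𝓣`-sets, for `h` `𝓐`-measurable integrable, `𝓖 ≤ 𝓐` and
`𝓣` independent of `𝓐`: `∫_S E[h|𝓖] = ∫_S h` (π-λ from the rectangles `u ∩ v`, on which both
sides equal `(∫_u h) μ(v)`; the function form of `setIntegral_condExp_indicator_eq_of_indep`).
[folklore] -/
theorem setIntegral_condExp_eq_of_indep {mG mA mT : MeasurableSpace Ω} (hGA : mG ≤ mA)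
    (hA : mA ≤ mΩ) (hT : mT ≤ mΩ) (hind : Indep mA mT μ) {h : Ω → ℝ}
    (hhm : StronglyMeasurable[mA] h) (hhi : Integrable h μ) {S : Set Ω}
    (hS : MeasurableSet[mG ⊔ mT] S) :
    ∫ x in S, (μ[h|mG]) x ∂μ = ∫ x in S, h x ∂μ := by
  have hG : mG ≤ mΩ := hGA.trans hA
  have hGT : mG ⊔ mT ≤ mΩ := sup_le hG hT
  have hgi : Integrable (μ[h|mG]) μ := integrable_condExp
  induction S, hS using MeasurableSpace.induction_on_inter
    (generateFrom_setOf_inter_eq_sup mG mT).symm (isPiSystem_setOf_inter mG mT) with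
  | empty => simp
  | basic S hS =>
    obtain ⟨u, v, hu, hv, rfl⟩ := hS
    rw [setIntegral_inter_eq_mul_of_indep hA hT hind (stronglyMeasurable_condExp.mono hGA)
        (hGA u hu) hv,
      setIntegral_inter_eq_mul_of_indep hA hT hind hhm (hGA u hu) hv, setIntegral_condExp hG hhi hu]
  | compl S hSm ih =>
    have hS₀ : MeasurableSet[mΩ] S := hGT S hSm
    have h1 := integral_add_compl hS₀ hgi
    have h2 := integral_add_compl hS₀ hhi
    rw [integral_condExp hG] at h1
    linarith
  | iUnion F hdisj hFm ih =>
    have hF₀ : ∀ i, MeasurableSet[mΩ] (F i) := fun i => hGT _ (hFm i)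
    rw [integral_iUnion hF₀ hdisj hgi.integrableOn, integral_iUnion hF₀ hdisj hhi.integrableOn]
    exact tsum_congr ih

/-- **An independent `σ`-algebra drops out of the conditioning** (D. Williams, *Probability with
Martingales*, §9.7 (k): if `𝓣` is independent of `σ(σ(h), 𝓖)` then `E[h | σ(𝓖, 𝓣)] = E[h | 𝓖]`):
for `𝓖 ≤ 𝓐`, `𝓣` independent of `𝓐`, and `h` `𝓐`-measurable integrable,
`E[h | 𝓖 ∨ 𝓣] = E[h | 𝓖]` a.e. [folklore] -/
theorem condExp_sup_ae_eq_condExp_of_indep {mG mA mT : MeasurableSpace Ω} (hGA : mG ≤ mA)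
    (hA : mA ≤ mΩ) (hT : mT ≤ mΩ) (hind : Indep mA mT μ) {h : Ω → ℝ}
    (hhm : StronglyMeasurable[mA] h) (hhi : Integrable h μ) :
    μ[h|mG ⊔ mT] =ᵐ[μ] μ[h|mG] := by
  have hG : mG ≤ mΩ := hGA.trans hA
  refine (ae_eq_condExp_of_forall_setIntegral_eq (sup_le hG hT) hhi
    (fun S _ _ => integrable_condExp.integrableOn)
    (fun S hS _ => setIntegral_condExp_eq_of_indep hGA hA hT hind hhm hhi hS)
    (stronglyMeasurable_condExp.mono (le_sup_left : mG ≤ mG ⊔ mT)).aestronglyMeasurable).symm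

end DropIndep

/-! ### First chaos over a Boolean algebra of independent, factorizing `σ`-algebras -/

section CellDecomposition

variable {Ω : Type*} {mΩ : MeasurableSpace Ω} {μ : Measure Ω} [IsFiniteMeasure μ] {X : Type*}

/-- **Cell decomposition of a first-chaos element** (Tsirelson 2014, Def. 1.1–1.2; Tsirelson 2003,
Lemma 115 `‖Q₁f‖² = lim Σ_k Var E(f|𝓕_{t_{k-1},t_k})`, the algebraic identity behind it).  Let
`W ↦ F W` assign sub-`σ`-algebras to the members of a Boolean algebra `𝒜` of subsets of `X`,
monotonically, with `F ∅` trivial, `F W` independent of `F Wᶜ`, and the FACTORIZATION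
`F (V ∪ W) ⊆ F V ∨ F W` mod `μ` for disjoint `V, W ∈ 𝒜` (a noise-type Boolean algebra: for the
percolation scaling limit these are Schramm–Smirnov's Cor. 1.8 and Thm. 1.7).  If `f` is in the
first chaos, `f = E[f | F W] + E[f | F Wᶜ]` a.e. for all `W ∈ 𝒜`, then for every finite disjoint
family `C i ∈ 𝒜`, `E[f | F (⋃ᵢ C i)] = Σᵢ E[f | F (C i)]` a.e.  (Induction on the family: with
`U = ⋃_{i ∈ t} C i`, `E[f | F(C ∪ U)] = E[f|F U] + E[E[f|F Uᶜ] | F C ∨ F U]` by the first-chaos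
identity at `U` and factorization, and the independent `F U` drops out of the last conditioning,
leaving `E[f | F C]` by the tower property.) [cite: Tsirelson2014, Def. 1.1–1.2] -/
theorem condExp_biUnion_ae_eq_sum_of_firstChaos {𝒜 : Set (Set X)} (h𝒜 : IsSetAlgebra 𝒜)
    (F : Set X → MeasurableSpace Ω) (hF : ∀ W ∈ 𝒜, F W ≤ mΩ)
    (hmono : ∀ V ∈ 𝒜, ∀ W ∈ 𝒜, V ⊆ W → F V ≤ F W)
    (hind : ∀ W ∈ 𝒜, Indep (F W) (F Wᶜ) μ)
    (hfac : ∀ V ∈ 𝒜, ∀ W ∈ 𝒜, Disjoint V W → ∀ s, MeasurableSet[F (V ∪ W)] s →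
      ∃ t, MeasurableSet[F V ⊔ F W] t ∧ s =ᵐ[μ] t)
    {f : Ω → ℝ} (hchaos : ∀ W ∈ 𝒜, f =ᵐ[μ] μ[f|F W] + μ[f|F Wᶜ])
    {ι : Type*} [DecidableEq ι] (C : ι → Set X) (s : Finset ι) (hC : ∀ i ∈ s, C i ∈ 𝒜)
    (hdisj : ∀ i ∈ s, ∀ j ∈ s, i ≠ j → Disjoint (C i) (C j)) (hbot : F ∅ = ⊥)
    (hf0 : ∫ ω, f ω ∂μ = 0) :
    μ[f|F (⋃ i ∈ s, C i)] =ᵐ[μ] fun ω => ∑ i ∈ s, (μ[f|F (C i)]) ω := by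
  induction s using Finset.induction_on with
  | empty =>
    have he : (⋃ i ∈ (∅ : Finset ι), C i) = (∅ : Set X) := by simp
    rw [he, hbot]
    filter_upwards [condExp_bot_ae_eq (μ := μ) (m₀ := mΩ) f] with ω hω
    simp [hω, hf0]
  | insert a t hat ih =>
    have hCt : ∀ i ∈ t, C i ∈ 𝒜 := fun i hi => hC i (Finset.mem_insert_of_mem hi)
    have hdt : ∀ i ∈ t, ∀ j ∈ t, i ≠ j → Disjoint (C i) (C j) := fun i hi j hj hij =>
      hdisj i (Finset.mem_insert_of_mem hi) j (Finset.mem_insert_of_mem hj) hij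
    have ih' := ih hCt hdt
    set U : Set X := ⋃ i ∈ t, C i with hUdef
    have hU : U ∈ 𝒜 := h𝒜.biUnion_mem t hCt
    have ha : C a ∈ 𝒜 := hC a (Finset.mem_insert_self a t)
    have haU : Disjoint (C a) U := by
      rw [hUdef, Set.disjoint_iUnion₂_right]
      intro j hj
      exact hdisj a (Finset.mem_insert_self a t) j (Finset.mem_insert_of_mem hj)
        (fun h => hat (h ▸ hj))
    have hU' : C a ∪ U ∈ 𝒜 := h𝒜.union_mem ha hU
    have hUc : Uᶜ ∈ 𝒜 := h𝒜.compl_mem hU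
    rw [Finset.set_biUnion_insert]
    -- the `σ`-algebras in play
    have hUU' : F U ≤ F (C a ∪ U) := hmono U hU _ hU' subset_union_right
    have haU' : F (C a) ≤ F (C a ∪ U) := hmono _ ha _ hU' subset_union_left
    have hU'Ω : F (C a ∪ U) ≤ mΩ := hF _ hU'
    have hUcΩ : F Uᶜ ≤ mΩ := hF _ hUc
    have hUΩ : F U ≤ mΩ := hF _ hU
    have haUc : F (C a) ≤ F Uᶜ := hmono _ ha _ hUc haU.subset_compl_right
    -- first chaos at `U`, conditioned on `F (C a ∪ U)`
    have h1 : μ[f|F (C a ∪ U)] =ᵐ[μ] μ[μ[f|F U] + μ[f|F Uᶜ]|F (C a ∪ U)] :=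
      condExp_congr_ae (hchaos U hU)
    have h2 : μ[μ[f|F U] + μ[f|F Uᶜ]|F (C a ∪ U)] =ᵐ[μ]
        μ[μ[f|F U]|F (C a ∪ U)] + μ[μ[f|F Uᶜ]|F (C a ∪ U)] :=
      condExp_add integrable_condExp integrable_condExp _
    have h3 : μ[μ[f|F U]|F (C a ∪ U)] = μ[f|F U] :=
      condExp_of_stronglyMeasurable hU'Ω (stronglyMeasurable_condExp.mono hUU')
        integrable_condExp
    have h4 : μ[μ[f|F Uᶜ]|F (C a ∪ U)] =ᵐ[μ] μ[μ[f|F Uᶜ]|F (C a) ⊔ F U] :=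
      condExp_ae_eq_condExp_of_forall_ae_eq (sup_le haU' hUU') hU'Ω (hfac _ ha _ hU haU)
        integrable_condExp
    have h5 : μ[μ[f|F Uᶜ]|F (C a) ⊔ F U] =ᵐ[μ] μ[μ[f|F Uᶜ]|F (C a)] :=
      condExp_sup_ae_eq_condExp_of_indep haUc hUcΩ hUΩ (hind U hU).symm
        stronglyMeasurable_condExp integrable_condExp
    have h6 : μ[μ[f|F Uᶜ]|F (C a)] =ᵐ[μ] μ[f|F (C a)] := condExp_condExp_of_le haUc hUcΩ
    have h456 := h4.trans (h5.trans h6)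
    filter_upwards [h1, h2, h456, ih'] with ω e1 e2 e3 e4
    rw [e1, e2, Pi.add_apply, h3, e3, e4, Finset.sum_insert hat, add_comm]

/-- **A first-chaos element is the sum of its cell projections**: under the hypotheses of
`condExp_biUnion_ae_eq_sum_of_firstChaos`, for a finite partition of `X` into cells `C i ∈ 𝒜`,
`f = Σᵢ E[f | F (C i)]` a.e. and `∫ f = 0` (the hypotheses `hdec`, `hf0` of
`ae_eq_zero_of_cellDecomposition_of_pivotal`). [cite: Tsirelson2014, Def. 1.2–1.3] -/
theorem ae_eq_sum_condExp_of_firstChaos {𝒜 : Set (Set X)} (h𝒜 : IsSetAlgebra 𝒜)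
    (F : Set X → MeasurableSpace Ω) (hF : ∀ W ∈ 𝒜, F W ≤ mΩ)
    (hmono : ∀ V ∈ 𝒜, ∀ W ∈ 𝒜, V ⊆ W → F V ≤ F W)
    (hind : ∀ W ∈ 𝒜, Indep (F W) (F Wᶜ) μ)
    (hfac : ∀ V ∈ 𝒜, ∀ W ∈ 𝒜, Disjoint V W → ∀ s, MeasurableSet[F (V ∪ W)] s →
      ∃ t, MeasurableSet[F V ⊔ F W] t ∧ s =ᵐ[μ] t)
    (hbot : F ∅ = ⊥) {f : Ω → ℝ} (hchaos : ∀ W ∈ 𝒜, f =ᵐ[μ] μ[f|F W] + μ[f|F Wᶜ])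
    {ι : Type*} [DecidableEq ι] (C : ι → Set X) (s : Finset ι) (hC : ∀ i ∈ s, C i ∈ 𝒜)
    (hdisj : ∀ i ∈ s, ∀ j ∈ s, i ≠ j → Disjoint (C i) (C j)) (hcover : ⋃ i ∈ s, C i = univ) :
    (f =ᵐ[μ] fun ω => ∑ i ∈ s, (μ[f|F (C i)]) ω) ∧ ∫ ω, f ω ∂μ = 0 := by
  have hempty : (∅ : Set X) ∈ 𝒜 := h𝒜.empty_mem
  have hf0 : ∫ ω, f ω ∂μ = 0 :=
    integral_eq_zero_of_ae_eq_condExp_add (hF _ hempty) (hF _ (h𝒜.compl_mem hempty))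
      (hchaos ∅ hempty)
  refine ⟨?_, hf0⟩
  have h := condExp_biUnion_ae_eq_sum_of_firstChaos h𝒜 F hF hmono hind hfac hchaos C s hC hdisj
    hbot hf0
  rw [hcover] at h
  have huniv := hchaos univ h𝒜.univ_mem
  rw [Set.compl_univ, hbot] at huniv
  have hb : μ[f|(⊥ : MeasurableSpace Ω)] =ᵐ[μ] (0 : Ω → ℝ) := by
    filter_upwards [condExp_bot_ae_eq (μ := μ) (m₀ := mΩ) f] with ω hω
    simp [hω, hf0]
  filter_upwards [huniv, hb, h] with ω e1 e2 e3
  rw [e1, Pi.add_apply, e2, e3, Pi.zero_apply, add_zero]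

end CellDecomposition

/-! ### The abstract blackness criterion (the measure-theoretic half of Remark 8a2) -/

section Criterion

variable {Ω : Type*} {mΩ : MeasurableSpace Ω} {μ : Measure Ω} [IsProbabilityMeasure μ]

/-- **Tsirelson's pivotal-cell argument, abstract form** (Tsirelson 2003, §6.5 Cor. 116–117 with
Lemma 113, as invoked by Schramm–Smirnov 2011, Cor. 1.8 via "[Ts03], Remark 8a2").  Let `μ` be a
probability measure, `f ∈ L²(μ)` with `∫ f = 0`, and `m n i` (`i ∈ P n`, `n ∈ ℕ`) finite families
of sub-`σ`-algebras ("the cells of the `n`-th grid"), each with an independent companion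
`m' n i` ("everything outside the cell"), such that
* `f = Σ_{i ∈ P n} E[f | m n i]` a.e. for every `n` — the cell decomposition of a first-chaos
  element (for a noise this is the first-chaos hypothesis, by the factorization property);
* for every event `A` of a `π`-system `S` generating the `σ`-algebra there are sandwich events
  `A⁻ n i ⊆ A ⊆ A⁺ n i` (a.e.) in `m' n i` — "`A` is decided outside the cell unless the cell is
  pivotal" — with `Σ_{i ∈ P n} μ(A⁺ n i ∖ A⁻ n i)² → 0` ("`O(1/ε²)` terms, `o(ε²)` each").
Then `f = 0` a.e.  (So if every first-chaos element admits such decompositions, the first chaos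
is `{0}`: the noise is black.) [cite: Tsirelson2003, §6.5 Cor. 116–117 and §8.1 Remark 137 (arXiv math/0301237)] -/
theorem ae_eq_zero_of_cellDecomposition_of_pivotal {ι : Type*} (P : ℕ → Finset ι)
    (m m' : ℕ → ι → MeasurableSpace Ω) (hm : ∀ n, ∀ i ∈ P n, m n i ≤ mΩ)
    (hm' : ∀ n, ∀ i ∈ P n, m' n i ≤ mΩ) (hind : ∀ n, ∀ i ∈ P n, Indep (m n i) (m' n i) μ)
    {S : Set (Set Ω)} (hgen : mΩ = MeasurableSpace.generateFrom S) (hS : IsPiSystem S)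
    {f : Ω → ℝ} (hf : MemLp f 2 μ) (hf0 : ∫ ω, f ω ∂μ = 0)
    (hdec : ∀ n, f =ᵐ[μ] fun ω => ∑ i ∈ P n, (μ[f|m n i]) ω)
    (hpiv : ∀ A ∈ S, ∃ Am Ap : ℕ → ι → Set Ω,
      (∀ n, ∀ i ∈ P n, MeasurableSet[m' n i] (Am n i) ∧ MeasurableSet[m' n i] (Ap n i) ∧
        (∀ᵐ ω ∂μ, ω ∈ Am n i → ω ∈ A) ∧ (∀ᵐ ω ∂μ, ω ∈ A → ω ∈ Ap n i)) ∧
      Tendsto (fun n => ∑ i ∈ P n, (μ.real (Ap n i \ Am n i)) ^ 2) atTop (nhds 0)) :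
    f =ᵐ[μ] 0 := by
  have hfi : Integrable f μ := hf.integrable one_le_two
  refine ae_eq_zero_of_forall_setIntegral_eq_zero_of_generateFrom hgen hS hfi hf0 fun A hA => ?_
  have hAmeas : MeasurableSet[mΩ] A := by
    rw [hgen]
    exact MeasurableSpace.measurableSet_generateFrom hA
  obtain ⟨Am, Ap, hsand, hlim⟩ := hpiv A hA
  set χ : Ω → ℝ := A.indicator fun _ => 1 with hχ
  have hχ2 : MemLp χ 2 μ := memLp_indicator_const 2 hAmeas (1 : ℝ) (Or.inr (measure_ne_top _ _))
  have e : ∫ ω, f ω * χ ω ∂μ = ∫ ω in A, f ω ∂μ := by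
    rw [← integral_indicator hAmeas]
    refine integral_congr_ae (Eventually.of_forall fun ω => ?_)
    by_cases h : ω ∈ A <;> simp [hχ, h]
  -- the bound at level `n`
  have hbound : ∀ n, |∫ ω in A, f ω ∂μ| ≤
      √(∫ ω, f ω ^ 2 ∂μ) * √(∑ i ∈ P n, (μ.real (Ap n i \ Am n i)) ^ 2) := by
    intro n
    have h1 := abs_integral_mul_le_of_ae_eq_sum (P n) (hm n) hf hχ2 hf0 (hdec n)
      (fun _ => μ.real A)
    rw [e] at h1
    refine h1.trans (mul_le_mul_of_nonneg_left (Real.sqrt_le_sqrt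
      (Finset.sum_le_sum fun i hi => ?_)) (Real.sqrt_nonneg _))
    obtain ⟨h_am, h_ap, h_le1, h_le2⟩ := hsand n i hi
    exact integral_sq_condExp_indicator_sub_le (hm n i hi) (hm' n i hi) (hind n i hi) hAmeas
      h_am h_ap h_le1 h_le2
  -- let `n → ∞`
  have hlim' : Tendsto (fun n => √(∫ ω, f ω ^ 2 ∂μ) *
      √(∑ i ∈ P n, (μ.real (Ap n i \ Am n i)) ^ 2)) atTop (nhds 0) := by
    have h := ((Real.continuous_sqrt.tendsto 0).comp hlim).const_mul (√(∫ ω, f ω ^ 2 ∂μ))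
    simpa using h
  have habs : |∫ ω in A, f ω ∂μ| ≤ 0 := ge_of_tendsto' hlim' hbound
  exact abs_nonpos_iff.1 habs

/-- **The abstract blackness criterion, `ε`-form with event-dependent partitions.**  Same as
`ae_eq_zero_of_cellDecomposition_of_pivotal`, but the finite family of cells (indexed by a fixed
type `κ`, cell `σ`-algebra `m k`, companion `m' k`) may be chosen depending on the event `A` and on
the accuracy `ε`: if for every `A` in a generating `π`-system and every `ε > 0` there is a finite
family `s` with `m k` independent of `m' k`, `f = Σ_{k ∈ s} E[f | m k]` a.e., and sandwich events
`A⁻ k ⊆ A ⊆ A⁺ k` (a.e.) in `m' k` with `Σ_{k ∈ s} μ(A⁺ k ∖ A⁻ k)² ≤ ε²`, then an `f ∈ L²` with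
`∫ f = 0` vanishes a.e. (For a noise every partition decomposes a first-chaos `f`,
`ae_eq_sum_condExp_of_firstChaos`, so the grid may be adapted to `A`.) [cite: Tsirelson2003, §6.5 Cor. 116–117 and §8.1 Remark 137 (arXiv math/0301237)] -/
theorem ae_eq_zero_of_forall_exists_cellDecomposition {κ : Type*} (m m' : κ → MeasurableSpace Ω)
    {S : Set (Set Ω)} (hgen : mΩ = MeasurableSpace.generateFrom S) (hS : IsPiSystem S)
    {f : Ω → ℝ} (hf : MemLp f 2 μ) (hf0 : ∫ ω, f ω ∂μ = 0)
    (h : ∀ A ∈ S, ∀ ε : ℝ, 0 < ε → ∃ s : Finset κ,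
      (∀ k ∈ s, m k ≤ mΩ ∧ m' k ≤ mΩ ∧ Indep (m k) (m' k) μ) ∧
      (f =ᵐ[μ] fun ω => ∑ k ∈ s, (μ[f|m k]) ω) ∧
      ∃ Am Ap : κ → Set Ω,
        (∀ k ∈ s, MeasurableSet[m' k] (Am k) ∧ MeasurableSet[m' k] (Ap k) ∧
          (∀ᵐ ω ∂μ, ω ∈ Am k → ω ∈ A) ∧ (∀ᵐ ω ∂μ, ω ∈ A → ω ∈ Ap k)) ∧
        ∑ k ∈ s, (μ.real (Ap k \ Am k)) ^ 2 ≤ ε ^ 2) :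
    f =ᵐ[μ] 0 := by
  have hfi : Integrable f μ := hf.integrable one_le_two
  refine ae_eq_zero_of_forall_setIntegral_eq_zero_of_generateFrom hgen hS hfi hf0 fun A hA => ?_
  have hAmeas : MeasurableSet[mΩ] A := by
    rw [hgen]
    exact MeasurableSpace.measurableSet_generateFrom hA
  set χ : Ω → ℝ := A.indicator fun _ => 1 with hχ
  have hχ2 : MemLp χ 2 μ := memLp_indicator_const 2 hAmeas (1 : ℝ) (Or.inr (measure_ne_top _ _))
  have e : ∫ ω, f ω * χ ω ∂μ = ∫ ω in A, f ω ∂μ := by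
    rw [← integral_indicator hAmeas]
    refine integral_congr_ae (Eventually.of_forall fun ω => ?_)
    by_cases h : ω ∈ A <;> simp [hχ, h]
  set K : ℝ := √(∫ ω, f ω ^ 2 ∂μ) with hK
  have hK0 : 0 ≤ K := Real.sqrt_nonneg _
  -- `|∫_A f| ≤ K ε` for every `ε > 0`
  have hbound : ∀ ε : ℝ, 0 < ε → |∫ ω in A, f ω ∂μ| ≤ K * ε := by
    intro ε hε
    obtain ⟨s, hs, hdec, Am, Ap, hsand, hsum⟩ := h A hA ε hε
    have h1 := abs_integral_mul_le_of_ae_eq_sum s (fun k hk => (hs k hk).1) hf hχ2 hf0 hdec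
      (fun _ => μ.real A)
    rw [e] at h1
    refine h1.trans (mul_le_mul_of_nonneg_left ?_ hK0)
    calc √(∑ k ∈ s, ∫ ω, ((μ[χ|m k]) ω - μ.real A) ^ 2 ∂μ)
        ≤ √(∑ k ∈ s, (μ.real (Ap k \ Am k)) ^ 2) := by
          refine Real.sqrt_le_sqrt (Finset.sum_le_sum fun k hk => ?_)
          obtain ⟨h_am, h_ap, h_le1, h_le2⟩ := hsand k hk
          exact integral_sq_condExp_indicator_sub_le (hs k hk).1 (hs k hk).2.1 (hs k hk).2.2
            hAmeas h_am h_ap h_le1 h_le2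
      _ ≤ √(ε ^ 2) := Real.sqrt_le_sqrt hsum
      _ = ε := Real.sqrt_sq hε.le
  have habs : |∫ ω in A, f ω ∂μ| ≤ 0 := by
    refine le_of_forall_pos_le_add fun ε hε => ?_
    have hKε : 0 < K + 1 := by linarith
    have h1 := hbound (ε / (K + 1)) (div_pos hε hKε)
    calc |∫ ω in A, f ω ∂μ| ≤ K * (ε / (K + 1)) := h1
      _ ≤ (K + 1) * (ε / (K + 1)) :=
          mul_le_mul_of_nonneg_right (by linarith) (div_pos hε hKε).le
      _ = 0 + ε := by rw [mul_div_cancel₀ _ hKε.ne', zero_add]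
  exact abs_nonpos_iff.1 habs

end Criterion

end Literature.Probability.Independence
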